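import Literature.AlgebraicGeometry.Frobenioids.DirectSumRealification
import HarnessLib

/-!
# Frobenioids I, Def. 2.4 (i): the realification of a direct sum `⊕_i M_i` of monoprime monoids IS the direct
# sum `⊕_𝔮 (M^pf_𝔮 ⊗ ℝ_{≥0})` of its `ℝ`-monoprime components

Mochizuki, *The geometry of Frobenioids I*, Kyushu J. Math. **62** (2008), Def. 2.4 (i) p. 48: "`M^rlf ⊆ M^rlf_factor
= ∏_𝔭 M^rlf_𝔭`" is the submonoid of the `a` with `Supp(a) ⊆ Supp(b)` for some `b ∈ M^pf`; Ex. 6.3 p. 113 /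
Thm. 6.4 (i) p. 115 (the realified arithmetic divisors, "`(Φ^rlf)^gp(L)`") [cite: MochizukiFrdI2008, Def. 2.4(i) p.48]
[cite: MochizukiFrdI2008, Thm. 6.4 (i) p.115].

PROOF-ONLY.  For `M = ⊕_i M_i` with MONOPRIME `M_i`: **`M^rlf = ⊕_𝔮 M^rlf_𝔮`** as submonoids of
`M^rlf_factor = ∏_𝔮 M^rlf_𝔮` (`DirectSum.realification_eq_directSum`): an element of `∏_𝔮 (M^pf_𝔮 ⊗ ℝ_{≥0})`
lies in `M^rlf` iff it is finitely supported (`⊆`: `DirectSum.supp_coe_rlf_finite`; `⊇`: a finite set of primes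
is the support of `ι(f)` for the `f ∈ ⊕_i M_i` with a generator at exactly those indices).  Each factor
`M^rlf_𝔮 = M^pf_𝔮 ⊗ ℝ_{≥0}` is `ℝ`-monoprime (`≅ ℝ_{≥0}`; tree: `isRMonoprime_realification_submonoid_primes_perfection`),
so `(⊕_i M_i)^rlf ≅ ⊕_𝔮 ℝ_{≥0}` — "the realified divisors are the finitely supported `ℝ_{≥0}`-valued divisors";
consumers obtain the isomorphism as `MulEquiv.submonoidCongr (DirectSum.realification_eq_directSum hM)`.
Seat abc-iut-L1-d2 (cell abc-iut).
-/

noncomputable section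

namespace Literature.AlgebraicGeometry.Frobenioids

open Function Literature.AnabelianGeometry.EtaleTheta

universe u v

namespace DirectSum

variable {ι : Type u} {M : ι → Type v} [∀ i, CommMonoid (M i)] [DecidableEq ι]
  (hM : ∀ i, IsMonoprime (M i))
include hM

/-- Every FINITE set of primes of `(⊕_i M_i)^pf` lies in the support of `ι(f)` for some `f ∈ ⊕_i M_i` (put a
generator of `M_i` at each index occurring). [cite: MochizukiFrdI2008, Def. 2.4(i) p.48] -/
theorem exists_supp_factorMap_of_supset {S : Set (Primes (Perfection (directSum M)))} (hS : S.Finite) :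
    ∃ f : directSum M, S ⊆ supp (factorMap (directSum M) (Perfection.of (directSum M) f)) := by
  classical
  let e := Primes.perfectionEquiv (isPerfFactorial hM).isDivisorial.isSharp
  let T : Finset ι := (hS.image fun 𝔮 => idx hM (e.symm 𝔮)).toFinset
  let g : ∀ i, M i := fun i => if i ∈ T then gen hM i else 1
  have hg : g ∈ directSum M := by
    refine T.finite_toSet.subset fun i hi => ?_
    rw [Finset.mem_coe]
    by_contra h
    exact hi (if_neg h)
  refine ⟨⟨g, hg⟩, fun 𝔮 h𝔮 => ?_⟩
  obtain ⟨𝔭, rfl⟩ := e.surjective 𝔮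
  rw [mem_supp_factorMap_of_iff hM]
  have hT : idx hM 𝔭 ∈ T := by
    rw [Set.Finite.mem_toFinset]
    exact ⟨e 𝔭, h𝔮, by simp only [Equiv.symm_apply_apply]⟩
  show g (idx hM 𝔭) ≠ 1
  simp only [g, if_pos hT]
  exact gen_ne_one hM _

/-- **`(⊕_i M_i)^rlf = ⊕_𝔮 (⊕_i M_i)^rlf_𝔮`**: the realification of a direct sum of monoprime monoids is the
submonoid of FINITELY SUPPORTED elements of `M^rlf_factor = ∏_𝔮 M^rlf_𝔮` (each `M^rlf_𝔮 ≅ ℝ_{≥0}`).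
[cite: MochizukiFrdI2008, Def. 2.4(i) p.48] -/
theorem realification_eq_directSum :
    (isPerfFactorial hM).realification =
      directSum (fun 𝔮 : Primes (Perfection (directSum M)) => RlfAt (directSum M) 𝔮) := by
  ext a
  rw [(isPerfFactorial hM).mem_realification_iff, mem_iff]
  constructor
  · rintro ⟨b, hb⟩
    exact (supp_factorMap_finite hM b).subset hb
  · intro ha
    obtain ⟨f, hf⟩ := exists_supp_factorMap_of_supset hM ha
    exact ⟨Perfection.of _ f, hf⟩

/-- Membership form: `a ∈ (⊕_i M_i)^rlf` iff `Supp(a)` is finite. [cite: MochizukiFrdI2008, Def. 2.4(i) p.48] -/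
theorem mem_realification_iff_supp_finite (a : RlfFactor (directSum M)) :
    a ∈ (isPerfFactorial hM).realification ↔ (supp a).Finite := by
  rw [realification_eq_directSum hM]
  rfl

/-- Each component monoid `M^rlf_𝔮 = M^pf_𝔮 ⊗ ℝ_{≥0}` of the direct sum is `ℝ`-monoprime (`≅ ℝ_{≥0}`).
[cite: MochizukiFrdI2008, Def. 2.4(i) p.48] -/
theorem isRMonoprime_rlfAt (𝔮 : Primes (Perfection (directSum M))) : IsRMonoprime (RlfAt (directSum M) 𝔮) :=
  isRMonoprime_realification_submonoid_primes_perfection (isPerfFactorial hM).isDivisorial.isSharp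
    (isPerfFactorial hM).isMonoprime 𝔮

end DirectSum

end Literature.AlgebraicGeometry.Frobenioids
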